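import Summits.Ventures.LatticeQCDFlow.TrivializingMaps.AnnealingAnyGroup

/-!
HONEST FRAMING: exact (Metropolis-corrected) sampling algorithms for lattice gauge theory; figures
of merit are autocorrelation/cost numbers at stated couplings and volumes; no continuum-physics
claim.

# Z2WilsonFisherZero — WEGNER'S `ℤ₂` LATTICE GAUGE THEORY: `Var_Haar(Re tr) = 1`, EVERY FINITE-VOLUME
# PARTITION FUNCTION HAS A FISHER ZERO WITH `|s₀| ≤ 4`, THE ZEROS ARE EXTENSIVE, SPECIFIC HEAT
# `1 + O(x)` PER PLAQUETTE, ONE STRONG-COUPLING REWEIGHTING STEP HAS `E[w²] ≥ exp(δ²·#plaq/2)`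
# (lean-2 GEN-9, ours)

Venture-side (OURS).  Cell `lqcd-flow` (pub-lqcd), unit `pub-lqcd-lean-2-g9`, 2026-08-22.  The finite
gauge group `ℤ₂ = Multiplicative (ZMod 2)` with the sign representation
`Literature.MathematicalPhysics.QuantumLattice.z2Rep` (`a ↦ (-1)^a`, Wegner 1971) is a compact second-
countable topological group (discrete), so the every-compact-group theorems of GEN-8 apply; the one
number they need is `Var_Haar(Re tr z2Rep) = 1` (`(Re tr)² ≡ 1`; the mean vanishes by invariance of Haar
under the generator).  As for `U(1)` in the tree, `[MeasurableSpace ℤ₂] [BorelSpace ℤ₂]` are instance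
ARGUMENTS (Mathlib registers no measurable structure on `Multiplicative (ZMod 2)`).

* `re_trace_z2Rep` (`Re tr z2Rep a = (-1)^a`), `re_trace_z2Rep_sq` (`= 1`), `integral_re_trace_z2Rep`
  (`= 0`), **`z2_variance_re_trace`** (`Var_Haar = 1`);
* **`z2_variance_wilsonAction`** — `Var_{D[U]}(S_W^{ℤ₂}) = #plaquettes` (`L ≥ 2`);
* **`z2_wilsonZ_exists_zero_norm_le_four`** — for every `d ≥ 2` and EVERY `L ≥ 2` the `ℤ₂` Wilson
  partition function `Z_L(s) = ∫ D[U] e^{-s ∑_p (1 − σ_p)}` has a zero with `|s₀| ≤ 4` (the `U(1)` /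
  `SU(2)` constant is `8`); `z2_wilsonZ_integral_exists_zero_norm_le_four` in Lüscher's notation;
* **`z2_wilsonZ_fisherZeros_extensive`** — `r = 1/(8e(3^d d²+1)²)`: zeros with `r ≤ |u| < R` of total
  multiplicity `≥ r²(1 − 4/R)·#plaq`, every `L ≥ 2`, every `R > 0`;
* **`z2_variance_sub_le`** — `|Var_x(S_W) − #plaq| ≤ 256·#plaq·|x|/r³` (`|x| < r/4`): specific heat per
  plaquette `1 + O(|x|)` uniformly in the volume;
* **`z2_weight_sq_ge_exp`** — one exact reweighting step with `[β, β+2δ]` in the window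
  `|x| ≤ min (r/8) (r³/512)` has `E[w²] ≥ exp(δ²·#plaq/2)`.

NOT CLAIMED: sharpness (`d = 2`: the zeros of the single-plaquette factor `1 + e^{-2s}` sit at
`|s| = π/2`); `L = 1`; self-duality / the `d = 3` Ising correspondence; anything outside the Kotecký–Preiss
window for the `β ≠ 0` items; cost / autocorrelation statements.  Literature grade (cell rule):
elementary; new typing only (Wegner, J. Math. Phys. 12 (1971) 2259 for the model).
-/

open MeasureTheory ProbabilityTheory Filter Topology Complex Set Metric MeromorphicOn
open Literature.MathematicalPhysics.QuantumFieldTheory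
open Literature.MathematicalPhysics.QuantumFieldTheory.Luscher2010
open Literature.MathematicalPhysics.QuantumLattice (z2Rep z2Rep_apply z2Rep_mem_unitaryGroup)

namespace Summit.Ventures.LatticeQCDFlow.TrivializingMaps

section Z2

variable [MeasurableSpace (Multiplicative (ZMod 2))] [BorelSpace (Multiplicative (ZMod 2))]

omit [MeasurableSpace (Multiplicative (ZMod 2))] [BorelSpace (Multiplicative (ZMod 2))] in
/-- `Re tr (z2Rep a) = (-1)^a`. [folklore] -/
theorem re_trace_z2Rep (a : Multiplicative (ZMod 2)) :
    ((z2Rep a).trace).re = (-1 : ℝ) ^ a.toAdd.val := by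
  rw [z2Rep_apply, Matrix.trace_smul, Matrix.trace_one, Fintype.card_fin, Nat.cast_one, smul_eq_mul,
    mul_one, show (-1 : ℂ) = ((-1 : ℝ) : ℂ) by norm_num, ← Complex.ofReal_pow, Complex.ofReal_re]

omit [MeasurableSpace (Multiplicative (ZMod 2))] [BorelSpace (Multiplicative (ZMod 2))] in
/-- `(Re tr (z2Rep a))² = 1`. [folklore] -/
theorem re_trace_z2Rep_sq (a : Multiplicative (ZMod 2)) : ((z2Rep a).trace).re ^ 2 = 1 := by
  rw [re_trace_z2Rep, ← pow_mul, mul_comm, pow_mul, neg_one_sq, one_pow]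

omit [MeasurableSpace (Multiplicative (ZMod 2))] [BorelSpace (Multiplicative (ZMod 2))] in
/-- Multiplication by the generator flips the sign character: `(-1)^{1+a} = -(-1)^a` on `ZMod 2`. [folklore] -/
theorem re_trace_z2Rep_gen_mul (a : Multiplicative (ZMod 2)) :
    ((z2Rep (Multiplicative.ofAdd (1 : ZMod 2) * a)).trace).re = -((z2Rep a).trace).re := by
  rw [re_trace_z2Rep, re_trace_z2Rep, toAdd_mul, toAdd_ofAdd]
  have hall : ∀ b : ZMod 2, b = 0 ∨ b = 1 := by decide
  rcases hall a.toAdd with hb | hb <;> rw [hb]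
  · rw [show ((1 + 0 : ZMod 2)).val = 1 from by decide, show (0 : ZMod 2).val = 0 from by decide]
    norm_num
  · rw [show ((1 + 1 : ZMod 2)).val = 0 from by decide, show (1 : ZMod 2).val = 1 from by decide]
    norm_num

omit [MeasurableSpace (Multiplicative (ZMod 2))] [BorelSpace (Multiplicative (ZMod 2))] in
/-- `z2Rep` is continuous (`ℤ₂` is discrete). [folklore] -/
theorem continuous_z2Rep : Continuous z2Rep := continuous_of_discreteTopology

/-- `∫_{ℤ₂} Re tr z2Rep = 0` (invariance of Haar under the generator). [folklore] -/
theorem integral_re_trace_z2Rep :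
    ∫ a, ((z2Rep a).trace).re ∂(haarProbability (Multiplicative (ZMod 2))) = 0 := by
  have h := integral_mul_left_eq_self (μ := haarProbability (Multiplicative (ZMod 2)))
    (fun a => ((z2Rep a).trace).re) (Multiplicative.ofAdd (1 : ZMod 2))
  simp only [re_trace_z2Rep_gen_mul, integral_neg] at h
  linarith

/-- **`Var_Haar(Re tr z2Rep) = 1`.** [ours] -/
theorem z2_variance_re_trace :
    variance (fun a => ((z2Rep a).trace).re) (haarProbability (Multiplicative (ZMod 2))) = 1 := by
  have hc : Continuous fun a : Multiplicative (ZMod 2) => ((z2Rep a).trace).re :=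
    continuous_of_discreteTopology
  have hm : MemLp (fun a : Multiplicative (ZMod 2) => ((z2Rep a).trace).re) 2
      (haarProbability (Multiplicative (ZMod 2))) :=
    MemLp.of_bound hc.aestronglyMeasurable 1 (ae_of_all _ fun a => by
      rw [Real.norm_eq_abs, ← sq_le_one_iff_abs_le_one, re_trace_z2Rep_sq])
  rw [variance_eq_sub hm]
  simp only [Pi.pow_apply, re_trace_z2Rep_sq, integral_const, smul_eq_mul, probReal_univ, one_mul,
    integral_re_trace_z2Rep]
  norm_num

/-! ## The `ℤ₂` Wilson theory in every volume -/

variable {d L : ℕ} [NeZero L]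

/-- **`Var_{D[U]}(S_W^{ℤ₂}) = #plaquettes`** (every `d`, every `L ≥ 2`). [ours] -/
theorem z2_variance_wilsonAction (hL : 2 ≤ L) :
    variance (wilsonAction (d := d) (L := L) z2Rep) (trivialMeasure (Multiplicative (ZMod 2)) d L) =
      Fintype.card (Plaquette d L) := by
  rw [variance_wilsonAction_eq_card_mul z2Rep continuous_z2Rep hL, z2_variance_re_trace, mul_one]

/-- **EVERY FINITE-VOLUME `ℤ₂` WILSON PARTITION FUNCTION HAS A FISHER ZERO WITH `|s₀| ≤ 4`** (`d ≥ 2`,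
every `L ≥ 2`). [ours] -/
theorem z2_wilsonZ_exists_zero_norm_le_four (hd : 2 ≤ d) (hL : 2 ≤ L) :
    ∃ s₀ : ℂ, ‖s₀‖ ≤ 4 ∧
      complexMGF (fun U => -wilsonAction z2Rep U) (trivialMeasure (Multiplicative (ZMod 2)) d L) s₀ = 0 := by
  obtain ⟨s₀, hs₀, hz⟩ := wilsonZ_exists_zero_norm_le_uniform (d := d) (L := L) z2Rep continuous_z2Rep
    hd hL (by rw [z2_variance_re_trace]; norm_num)
  refine ⟨s₀, ?_, hz⟩
  rw [z2_variance_re_trace] at hs₀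
  calc ‖s₀‖ ≤ 4 * ((1 : ℕ) : ℝ) / 1 := hs₀
    _ = 4 := by norm_num

/-- Lüscher's notation: a zero of `s ↦ ∫ D[U] e^{-sS_W}` with `|s₀| ≤ 4`, every `L ≥ 2`. [ours] -/
theorem z2_wilsonZ_integral_exists_zero_norm_le_four (hd : 2 ≤ d) (hL : 2 ≤ L) :
    ∃ s₀ : ℂ, ‖s₀‖ ≤ 4 ∧
      ∫ U, cexp (-(s₀ * (wilsonAction z2Rep U : ℂ))) ∂(trivialMeasure (Multiplicative (ZMod 2)) d L) = 0 := by
  obtain ⟨s₀, hs₀, hz⟩ := z2_wilsonZ_exists_zero_norm_le_four (d := d) (L := L) hd hL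
  exact ⟨s₀, hs₀, by rw [← WilsonPinching.complexMGF_neg_wilsonAction z2Rep s₀]; exact hz⟩

omit [MeasurableSpace (Multiplicative (ZMod 2))] [BorelSpace (Multiplicative (ZMod 2))] [NeZero L] in
/-- The closed-form `ℤ₂` radius: `1/(4e·max(1,2)·K) = 1/(8e·K)`. [ours] -/
theorem z2_kpRadius_eq (K : ℝ) :
    1 / (4 * Real.exp 1 * max 1 (2 * ((1 : ℕ) : ℝ)) * K) = 1 / (8 * Real.exp 1 * K) := by
  have hmax : max 1 (2 * ((1 : ℕ) : ℝ)) = 2 := by norm_num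
  rw [hmax]; ring

/-- **`ℤ₂`: THE FISHER ZEROS ARE EXTENSIVE** — for every `d`, every `L ≥ 2`, every `R > 0`, with
`r = 1/(8e(3^d d² + 1)²)`: zeros `u` with `r ≤ |u| < R` of total multiplicity `≥ r²·(1 − 4/R)·#plaq`. [ours] -/
theorem z2_wilsonZ_fisherZeros_extensive (hL : 2 ≤ L) (R : ℝ) (hR : 0 < R) :
    ∃ T : Finset ℂ, (∀ u ∈ T,
        complexMGF (fun U => -wilsonAction z2Rep U) (trivialMeasure (Multiplicative (ZMod 2)) d L) u = 0 ∧
          1 / (8 * Real.exp 1 * ((3 : ℝ) ^ d * (d : ℝ) ^ 2 + 1) ^ 2) ≤ ‖u‖ ∧ ‖u‖ < R ∧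
          1 ≤ divisor (complexMGF (fun U => -wilsonAction z2Rep U)
            (trivialMeasure (Multiplicative (ZMod 2)) d L)) (closedBall (0 : ℂ) (2 * R)) u) ∧
      (1 / (8 * Real.exp 1 * ((3 : ℝ) ^ d * (d : ℝ) ^ 2 + 1) ^ 2)) ^ 2 * (1 - 4 / R) *
          Fintype.card (Plaquette d L) ≤
        ∑ u ∈ T, (divisor (complexMGF (fun U => -wilsonAction z2Rep U)
            (trivialMeasure (Multiplicative (ZMod 2)) d L)) (closedBall (0 : ℂ) (2 * R)) u : ℝ) := by
  obtain ⟨T, hT, hsum⟩ := wilsonZ_fisherZeros_extensive_anyGroup (d := d) (L := L) z2Rep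
    continuous_z2Rep z2Rep_mem_unitaryGroup hL R hR
  have hr := z2_kpRadius_eq (((3 : ℝ) ^ d * (d : ℝ) ^ 2 + 1) ^ 2)
  refine ⟨T, fun u hu => ?_, ?_⟩
  · obtain ⟨h1, h2, h3, h4⟩ := hT u hu
    exact ⟨h1, hr ▸ h2, h3, h4⟩
  · rw [z2_variance_re_trace, hr] at hsum
    have h4 : (4 : ℝ) * ((1 : ℕ) : ℝ) / R = 4 / R := by norm_num
    rwa [h4] at hsum

/-- **`ℤ₂` SPECIFIC HEAT AT STRONG COUPLING, UNIFORMLY IN THE VOLUME**: for every `L ≥ 2` and real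
`|x| < r/4`, `r = 1/(8e(3^d d²+1)²)`: `|Var_x(S_W^{ℤ₂}) − #plaq| ≤ 256·#plaq·|x|/r³`. [ours] -/
theorem z2_variance_sub_le (hL : 2 ≤ L) (x : ℝ)
    (hx : |x| < 1 / (8 * Real.exp 1 * ((3 : ℝ) ^ d * (d : ℝ) ^ 2 + 1) ^ 2) / 4) :
    |variance (wilsonAction (d := d) (L := L) z2Rep)
        (wilsonMeasure (d := d) (L := L) z2Rep x) - Fintype.card (Plaquette d L)| ≤
      256 * Fintype.card (Plaquette d L) * |x| / (1 / (8 * Real.exp 1 * ((3 : ℝ) ^ d * (d : ℝ) ^ 2 + 1) ^ 2)) ^ 3 := by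
  have hr := z2_kpRadius_eq (((3 : ℝ) ^ d * (d : ℝ) ^ 2 + 1) ^ 2)
  have h := wilson_variance_sub_le_anyGroup (d := d) (L := L) z2Rep continuous_z2Rep
    z2Rep_mem_unitaryGroup hL x (by rw [hr]; exact hx)
  rw [z2_variance_re_trace, hr, mul_one] at h
  exact h

/-- **`ℤ₂`, STRONG COUPLING, EVERY `L ≥ 2`: one exact reweighting step `β → β + δ` (`δ ≥ 0`) with
`[β, β+2δ]` inside `|x| ≤ min (r/8) (r³/512)`, `r = 1/(8e(3^d d²+1)²)`, has importance-weight second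
moment `≥ exp(δ²·#plaq/2)`.** [ours] -/
theorem z2_weight_sq_ge_exp (hL : 2 ≤ L) {β δ : ℝ} (hδ : 0 ≤ δ)
    (hβ : |β| ≤ min (1 / (8 * Real.exp 1 * ((3 : ℝ) ^ d * (d : ℝ) ^ 2 + 1) ^ 2) / 8)
      ((1 / (8 * Real.exp 1 * ((3 : ℝ) ^ d * (d : ℝ) ^ 2 + 1) ^ 2)) ^ 3 / 512))
    (hβ2 : |β + 2 * δ| ≤ min (1 / (8 * Real.exp 1 * ((3 : ℝ) ^ d * (d : ℝ) ^ 2 + 1) ^ 2) / 8)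
      ((1 / (8 * Real.exp 1 * ((3 : ℝ) ^ d * (d : ℝ) ^ 2 + 1) ^ 2)) ^ 3 / 512)) :
    Real.exp (δ ^ 2 * (Fintype.card (Plaquette d L) / 2)) ≤
      ∫ U, (Real.exp (-(δ * wilsonAction z2Rep U)) *
        (mgf (fun U => -wilsonAction z2Rep U) (trivialMeasure (Multiplicative (ZMod 2)) d L) β /
          mgf (fun U => -wilsonAction z2Rep U) (trivialMeasure (Multiplicative (ZMod 2)) d L) (β + δ))) ^ 2
      ∂(wilsonMeasure (d := d) (L := L) z2Rep β) := by
  have hr := z2_kpRadius_eq (((3 : ℝ) ^ d * (d : ℝ) ^ 2 + 1) ^ 2)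
  have h := wilson_weight_sq_ge_exp_anyGroup (d := d) (L := L) z2Rep continuous_z2Rep
    z2Rep_mem_unitaryGroup hL hδ (by rw [hr, z2_variance_re_trace, one_mul]; exact hβ)
    (by rw [hr, z2_variance_re_trace, one_mul]; exact hβ2)
  rw [z2_variance_re_trace, one_mul] at h
  exact h

end Z2

end Summit.Ventures.LatticeQCDFlow.TrivializingMaps
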